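import Literature.AlgebraicGeometry.AbelianSchemes.DualIsogenyDegree
import Literature.AlgebraicGeometry.Motives.AbelianVarietyPoincareCompleteReducibility
import Literature.AlgebraicGeometry.Motives.AbelianVarietyRationalTorsionReduction
import Literature.AlgebraicGeometry.AbelianSchemes.AbelianSchemeOverFibreDim
import HarnessLib

/-!
# A homomorphism of abelian varieties with FINITELY MANY POINTS IN ITS KERNEL is an isogeny (given the dimension count):
# the two legs of an isogeny roof `A —q→ B ←c— A″` are finite and surjective

Topic `Literature/AlgebraicGeometry/AbelianSchemes`, namespace `Literature.AlgebraicGeometry.AbelianSchemes.AbelianSchemeOver`.  THEOREMS ONLY (no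
definition, no named fact, no `instance`, no notation, no `sorry`).  Cell `hodgecm-mathlib` (D-0151), FLOOR 0, P6 «MOD programme» (crux hLiu418 =
stmt-HodgeConjecture-24832, `--supports`, count-neutral), σ2 (β′) lineage of `stub_HFROB`, organ **«THE ROOF LEGS ARE ISOGENIES»**: the moduli datum's
isogeny roof `RoofΩ` (Defs (ii-4)) records `q : A_y → B`, `c : A_y″ → B` as HOMOMORPHISMS with (r1) `Ker q(Ω) = K` a finite subgroup of points, (r2)
`Ker c(Ω) = A_y″[𝔞](Ω)` and `c` surjective on points — whereas the consumers want the `MorphismProperty` instances `[IsFinite q.left] [Surjective q.left]`,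
`[IsFinite c.left]` (★ `EtaleKernelDecidedOnPoints` §3, ★ `AbelianSchemeHomExtensionFromDedekindStage` `huLs`∕`huLf`, ★ `AbelianSchemeHomDescentKernelEq`).
This file reads them off, in the `AbelianSchemeOver (Spec Ω)` ∕ `AlgPoints.map` currency of the datum, from the tree's abelian-variety library: a
homomorphism with finitely many `Ω`-points in its kernel onto an abelian variety of no larger dimension is an isogeny (★
`Motives.AbelianVariety.isIsogeny_of_finite_of_dim_le`, [MumfordAV1970] §19 Thm. 1 (proof, p. 174), §6 Application 3 (pp. 62–64)); a surjective homomorphism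
does not increase the dimension ([GortzWedhorn2023] Prop. 27.176); isogenous abelian varieties have the same dimension (★ `dim_eq_of_isIsogeny`); the
`N`-torsion of `A(Ω)` is finite for `N ≠ 0` (★ `finite_torsionPoints_of_ne_zero`, [MumfordAV1970] §6 Application 3 (p. 64)).  HC_CM is proved only modulo the 2
remaining named inputs (hLiu418, h413) until rung 0 closes; this file discharges none of them.

## Contents (`Ω` a field, `A A″ B : AbelianSchemeOver (Spec Ω)`, `ψ : A.X ⟶ B.X` a homomorphism; `Ω = Ω̄` from §2 on)
* §1 `dim_le_of_surjective_left` (`ψ.left` surjective ⇒ `dim B ≤ dim A`), `surjective_left_of_surjective_base`.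
* §2 **`surjective_left_of_finite_setOf_map_eq_one`**, **`isFinite_left_of_finite_setOf_map_eq_one`** (finitely many `Ω`-points in the kernel +
  `dim B ≤ dim A` ⇒ `ψ.left` surjective and finite), `dim_eq_of_finite_setOf_map_eq_one`; **`isFinite_left_of_surjective_of_finite_setOf_map_eq_one`**
  (surjective + finitely many kernel points ⇒ finite), `dim_eq_of_surjective_of_finite_setOf_map_eq_one`.
* §3 **`roof_legs_isFinite_surjective`** — the roof form: `q : A → B` with finitely many kernel points, `c : A″ → B` surjective with finitely many kernel
  points, `dim A = dim A″` ⇒ `Surjective q.left ∧ IsFinite q.left ∧ Surjective c.left ∧ IsFinite c.left`; `…_of_isOfRelDim` (both `A`, `A″` of relative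
  dimension `g`, e.g. two fibres of one abelian scheme ★ `IsOfRelDim.fibre`).
* §4 suppliers of the finiteness hypothesis in the datum's shapes: `finite_setOf_map_eq_one_of_iff_mem` ((r1): `ψ(P) = 1 ↔ P ∈ K`, `K` finite),
  **`finite_setOf_map_eq_one_of_pow_eq_one`** ((r2): every kernel point is `n`-torsion for some `n ≠ 0`, e.g. `p ∈ 𝔞`), `finite_setOf_forall_of_pow_eq_one`.

## References
* [MumfordAV1970] D. Mumford, *Abelian Varieties* (1970), §6 Application 3 (pp. 62–64, Proposition p. 64), §19 Thm. 1 (p. 174).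
* [GortzWedhorn2023] U. Görtz, T. Wedhorn, *Algebraic Geometry II* (2023), Prop. 27.176, Cor. 27.177.
-/

noncomputable section

universe u

open CategoryTheory CategoryTheory.Limits AlgebraicGeometry MonoidalCategory CartesianMonoidalCategory
open scoped MonObj

namespace Literature.AlgebraicGeometry.AbelianSchemes

namespace AbelianSchemeOver

open Literature.AlgebraicGeometry.Motives (AlgPoints SchemeOver specOver)
open Literature.AlgebraicGeometry.Motives.AbelianVariety

variable {Ω : Type u} [Field Ω] {A A'' B : AbelianSchemeOver (Spec (.of Ω))} (ψ : A.X ⟶ B.X) [IsMonHom ψ]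

/-! ## §1 Dictionary: `Over`-currency instances versus the abelian-variety library -/

omit [IsMonHom ψ] in
/-- `Surjective ψ.left` from surjectivity of the underlying map (the `Function.Surjective c.left.base` clause of `RoofΩ` (r2)).
[cite: GortzWedhorn2023, Prop. 27.176] -/
theorem surjective_left_of_surjective_base (hs : Function.Surjective ψ.left.base) : Surjective ψ.left :=
  ⟨hs⟩

/-- **A surjective homomorphism does not increase the dimension**: `ψ.left` surjective ⇒ `dim B ≤ dim A` (a proper surjection is a closed, hence
specialising, surjection, so chains of specialisations lift). [cite: GortzWedhorn2023, Prop. 27.176] -/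
theorem dim_le_of_surjective_left [Surjective ψ.left] : B.toAffine.toAbelianVariety.dim ≤ A.toAffine.toAbelianVariety.dim := by
  haveI : Surjective (Hom.toSchemeHom (homOfIsMonHom ψ)) := ‹Surjective ψ.left›
  have h := Motives.Scheme.topologicalKrullDim_le_of_universallyClosed_of_surjective (Hom.toSchemeHom (homOfIsMonHom ψ))
  rw [topologicalKrullDim_left, topologicalKrullDim_left] at h
  exact_mod_cast h

/-- The kernel of `ψ` on `Ω`-points, read in the abelian-variety library's spelling (`R ≫ f.hom.hom.hom = 1` for `f = homOfIsMonHom ψ`) is the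
datum's `{P | AlgPoints.map ψ P = 1}` (same carriers, `AlgPoints.map ψ P = P ≫ ψ`). [cite: MumfordAV1970, §6 Application 3 (pp. 62–64)] -/
theorem setOf_comp_homOfIsMonHom_eq_one_eq :
    {R : A.toAffine.toAbelianVariety.Points Ω | R ≫ (homOfIsMonHom ψ).hom.hom.hom = 1} =
      {P : A.toAffine.toAbelianVariety.Points Ω | (AlgPoints.map ψ P : B.toAffine.toAbelianVariety.Points Ω) = 1} :=
  rfl

/-! ## §2 Finitely many kernel points ⇒ isogeny -/

section AlgClosed

variable [IsAlgClosed Ω]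

/-- **FINITELY MANY KERNEL POINTS + `dim B ≤ dim A` ⇒ `ψ` IS SURJECTIVE** (`Ω = Ω̄`; the image has dimension `dim A ≥ dim B`).
[cite: MumfordAV1970, §19 Thm. 1 (proof, p. 174)] [cite: GortzWedhorn2023, Prop. 27.176] -/
theorem surjective_left_of_finite_setOf_map_eq_one
    (hfin : {P : A.toAffine.toAbelianVariety.Points Ω | (AlgPoints.map ψ P : B.toAffine.toAbelianVariety.Points Ω) = 1}.Finite)
    (hdim : B.toAffine.toAbelianVariety.dim ≤ A.toAffine.toAbelianVariety.dim) : Surjective ψ.left := by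
  have h := isIsogeny_of_finite_of_dim_le (homOfIsMonHom ψ) (by rw [setOf_comp_homOfIsMonHom_eq_one_eq]; exact hfin) hdim
  exact h.1

/-- **FINITELY MANY KERNEL POINTS + `dim B ≤ dim A` ⇒ `ψ` IS FINITE** (`Ω = Ω̄`). [cite: MumfordAV1970, §19 Thm. 1 (proof, p. 174), §6 Application 3 (pp. 62–64)]
[cite: GortzWedhorn2023, Cor. 27.177] -/
theorem isFinite_left_of_finite_setOf_map_eq_one
    (hfin : {P : A.toAffine.toAbelianVariety.Points Ω | (AlgPoints.map ψ P : B.toAffine.toAbelianVariety.Points Ω) = 1}.Finite)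
    (hdim : B.toAffine.toAbelianVariety.dim ≤ A.toAffine.toAbelianVariety.dim) : IsFinite ψ.left := by
  have h := isIsogeny_of_finite_of_dim_le (homOfIsMonHom ψ) (by rw [setOf_comp_homOfIsMonHom_eq_one_eq]; exact hfin) hdim
  exact h.2

/-- … and then `dim A = dim B`. [cite: MumfordAV1970, §6 Application 3 (pp. 62–64)] -/
theorem dim_eq_of_finite_setOf_map_eq_one
    (hfin : {P : A.toAffine.toAbelianVariety.Points Ω | (AlgPoints.map ψ P : B.toAffine.toAbelianVariety.Points Ω) = 1}.Finite)
    (hdim : B.toAffine.toAbelianVariety.dim ≤ A.toAffine.toAbelianVariety.dim) :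
    A.toAffine.toAbelianVariety.dim = B.toAffine.toAbelianVariety.dim :=
  dim_eq_of_isIsogeny (isIsogeny_of_finite_of_dim_le (homOfIsMonHom ψ) (by rw [setOf_comp_homOfIsMonHom_eq_one_eq]; exact hfin) hdim)

/-- **SURJECTIVE + FINITELY MANY KERNEL POINTS ⇒ FINITE** (`Ω = Ω̄`; the shape of `RoofΩ` (r2): `dim B ≤ dim A″` by §1, then §2).
[cite: MumfordAV1970, §19 Thm. 1 (proof, p. 174), §6 Application 3 (pp. 62–64)] [cite: GortzWedhorn2023, Prop. 27.176 and Cor. 27.177] -/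
theorem isFinite_left_of_surjective_of_finite_setOf_map_eq_one [Surjective ψ.left]
    (hfin : {P : A.toAffine.toAbelianVariety.Points Ω | (AlgPoints.map ψ P : B.toAffine.toAbelianVariety.Points Ω) = 1}.Finite) :
    IsFinite ψ.left :=
  isFinite_left_of_finite_setOf_map_eq_one ψ hfin (dim_le_of_surjective_left ψ)

/-- … and then `dim A = dim B`. [cite: MumfordAV1970, §6 Application 3 (pp. 62–64)] -/
theorem dim_eq_of_surjective_of_finite_setOf_map_eq_one [Surjective ψ.left]
    (hfin : {P : A.toAffine.toAbelianVariety.Points Ω | (AlgPoints.map ψ P : B.toAffine.toAbelianVariety.Points Ω) = 1}.Finite) :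
    A.toAffine.toAbelianVariety.dim = B.toAffine.toAbelianVariety.dim :=
  dim_eq_of_finite_setOf_map_eq_one ψ hfin (dim_le_of_surjective_left ψ)

/-! ## §3 The roof form -/

/-- **THE ROOF LEGS ARE ISOGENIES** (`Ω = Ω̄`): for homomorphisms `q : A → B`, `c : A″ → B` of abelian `Ω`-schemes with `c` surjective on points, finitely
many `Ω`-points in each kernel, and `dim A = dim A″`: `q.left` and `c.left` are surjective and finite (so every isogeny engine applies to both legs:
`dim B = dim A″ = dim A`). [cite: MumfordAV1970, §19 Thm. 1 (proof, p. 174), §6 Application 3 (pp. 62–64)] [cite: GortzWedhorn2023, Prop. 27.176 and Cor. 27.177] -/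
theorem roof_legs_isFinite_surjective (q : A.X ⟶ B.X) [IsMonHom q] (c : A''.X ⟶ B.X) [IsMonHom c]
    (hc : Function.Surjective c.left.base)
    (hqfin : {P : A.toAffine.toAbelianVariety.Points Ω | (AlgPoints.map q P : B.toAffine.toAbelianVariety.Points Ω) = 1}.Finite)
    (hcfin : {P : A''.toAffine.toAbelianVariety.Points Ω | (AlgPoints.map c P : B.toAffine.toAbelianVariety.Points Ω) = 1}.Finite)
    (hdim : A.toAffine.toAbelianVariety.dim = A''.toAffine.toAbelianVariety.dim) :
    Surjective q.left ∧ IsFinite q.left ∧ Surjective c.left ∧ IsFinite c.left := by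
  haveI : Surjective c.left := ⟨hc⟩
  have hB : B.toAffine.toAbelianVariety.dim ≤ A.toAffine.toAbelianVariety.dim := by
    rw [hdim, dim_eq_of_surjective_of_finite_setOf_map_eq_one c hcfin]
  exact ⟨surjective_left_of_finite_setOf_map_eq_one q hqfin hB, isFinite_left_of_finite_setOf_map_eq_one q hqfin hB, inferInstance,
    isFinite_left_of_surjective_of_finite_setOf_map_eq_one c hcfin⟩

/-- **THE ROOF LEGS ARE ISOGENIES, relative-dimension form**: the same when `A` and `A″` both have relative dimension `g` over `Spec Ω` (e.g. two
geometric fibres of ONE abelian scheme of relative dimension `g`, ★ `IsOfRelDim.fibre` ∕ `IsOfRelDim.baseChange`).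
[cite: MumfordAV1970, §19 Thm. 1 (proof, p. 174), §6 Application 3 (pp. 62–64)] [cite: GortzWedhorn2023, Prop. 27.176 and Cor. 27.177] -/
theorem roof_legs_isFinite_surjective_of_isOfRelDim {g : ℕ} (hA : A.IsOfRelDim g) (hA'' : A''.IsOfRelDim g)
    (q : A.X ⟶ B.X) [IsMonHom q] (c : A''.X ⟶ B.X) [IsMonHom c]
    (hc : Function.Surjective c.left.base)
    (hqfin : {P : A.toAffine.toAbelianVariety.Points Ω | (AlgPoints.map q P : B.toAffine.toAbelianVariety.Points Ω) = 1}.Finite)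
    (hcfin : {P : A''.toAffine.toAbelianVariety.Points Ω | (AlgPoints.map c P : B.toAffine.toAbelianVariety.Points Ω) = 1}.Finite) :
    Surjective q.left ∧ IsFinite q.left ∧ Surjective c.left ∧ IsFinite c.left :=
  have hd : ∀ {A₁ : AbelianSchemeOver (Spec (.of Ω))}, A₁.IsOfRelDim g → A₁.toAffine.toAbelianVariety.dim = g := fun {A₁} h₁ => by
    have h₂ : SmoothOfRelativeDimension A₁.toAffine.toAbelianVariety.dim A₁.toAffine.X.hom := A₁.toAffine.isOfRelDim_dim
    haveI : Nonempty A₁.toAffine.X.left := ⟨Motives.AbelianVariety.origin A₁.toAffine.toAbelianVariety⟩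
    exact Motives.AbelianVarietyProofs.eq_of_smoothOfRelativeDimension _ h₂ h₁
  roof_legs_isFinite_surjective q c hc hqfin hcfin ((hd hA).trans (hd hA'').symm)

end AlgClosed

/-! ## §4 Finiteness of the kernel points in the datum's shapes -/

omit [IsMonHom ψ] in
/-- (r1) shape: `ψ(P) = 1 ↔ P ∈ K` for a finite subgroup `K` of `A(Ω)` ⇒ finitely many kernel points. [cite: MumfordAV1970, §6 Application 3 (pp. 62–64)] -/
theorem finite_setOf_map_eq_one_of_iff_mem (K : Subgroup (A.toAffine.toAbelianVariety.Points Ω)) [Finite K]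
    (h : ∀ P : A.toAffine.toAbelianVariety.Points Ω, (AlgPoints.map ψ P : B.toAffine.toAbelianVariety.Points Ω) = 1 ↔ P ∈ K) :
    {P : A.toAffine.toAbelianVariety.Points Ω | (AlgPoints.map ψ P : B.toAffine.toAbelianVariety.Points Ω) = 1}.Finite := by
  have hK : (K : Set (A.toAffine.toAbelianVariety.Points Ω)).Finite := Set.toFinite _
  exact hK.subset fun P hP => (h P).1 hP

omit [IsMonHom ψ] in
/-- (r2) shape: every kernel point is `n`-torsion for ONE `n ≠ 0` (e.g. `Ker c(Ω) = A[𝔞](Ω)` with `0 ≠ n ∈ 𝔞 ∩ ℤ`) ⇒ finitely many kernel points — the `n`-torsion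
`A(Ω)[n]` is finite (★ `finite_torsionPoints_of_ne_zero`). [cite: MumfordAV1970, §6 Application 3 (Proposition p. 64)] -/
theorem finite_setOf_map_eq_one_of_pow_eq_one (n : ℕ) (hn : n ≠ 0)
    (h : ∀ P : A.toAffine.toAbelianVariety.Points Ω, (AlgPoints.map ψ P : B.toAffine.toAbelianVariety.Points Ω) = 1 → P ^ n = 1) :
    {P : A.toAffine.toAbelianVariety.Points Ω | (AlgPoints.map ψ P : B.toAffine.toAbelianVariety.Points Ω) = 1}.Finite := by
  haveI := A.toAffine.toAbelianVariety.finite_torsionPoints_of_ne_zero (K := Ω) (N := (n : ℤ)) (by exact_mod_cast hn)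
  have hT : (A.toAffine.toAbelianVariety.torsionPoints Ω (n : ℤ) : Set (A.toAffine.toAbelianVariety.Points Ω)).Finite := Set.toFinite _
  refine hT.subset fun P hP => ?_
  rw [SetLike.mem_coe, mem_torsionPoints_iff, zpow_natCast]
  exact h P hP

/-- (r2) shape, family form: the points killed by a family of conditions each of which forces `n`-torsion (e.g. `∀ a ∈ 𝔞, ι(a)(P) = 1` with `0 ≠ n ∈ 𝔞`) are
finitely many. [cite: MumfordAV1970, §6 Application 3 (Proposition p. 64)] -/
theorem finite_setOf_of_pow_eq_one (T : A.toAffine.toAbelianVariety.Points Ω → Prop) (n : ℕ) (hn : n ≠ 0)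
    (h : ∀ P : A.toAffine.toAbelianVariety.Points Ω, T P → P ^ n = 1) : {P | T P}.Finite := by
  haveI := A.toAffine.toAbelianVariety.finite_torsionPoints_of_ne_zero (K := Ω) (N := (n : ℤ)) (by exact_mod_cast hn)
  have hT : (A.toAffine.toAbelianVariety.torsionPoints Ω (n : ℤ) : Set (A.toAffine.toAbelianVariety.Points Ω)).Finite := Set.toFinite _
  refine hT.subset fun P hP => ?_
  rw [SetLike.mem_coe, mem_torsionPoints_iff, zpow_natCast]
  exact h P hP

end AbelianSchemeOver

end Literature.AlgebraicGeometry.AbelianSchemes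

end
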